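import Mathlib
import HarnessLib
import Summits.PneNP.PneNP.Theses.OneSlice
import Literature.Computability.Complexity.RossmanMonotoneClique

/-!
# Sketch — crux-ideate `stmt-PneNP-2832` (`OneSlice.SliceTarget`), round 1, ideator 3

First lemmas of the two idea cards, typed over existing declarations
(`Literature.Computability.Complexity.{Circuit, monotoneBasis, cliqueFn, cliqueCount, edgeCount}`,
the route decl `Summit.PneNP.PneNP.Theses.OneSlice.SliceTarget`).  Statements are `def … : Prop`
(unproved) except the two pointwise lemmas of card 1, which are proved here.

* Card 1 `critical-modq-coincidence`: `modqFn`, `tailCard`, `cliqueFn_eq_modqFn_of_lt`,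
  `sliceErr_modq_le`, `CoincidenceTail`, `ModqSliceHard`, `TransferModq`.
* Card 2 `subquadratic-window-occupancy`: `DependsOn`, `ReadingLemma`, `SizeGeReads`,
  `SliceTargetAt`, `FactorsThroughOccupancy`, `OccupancyBlindness`, `OccupancyFloor`,
  `chainEval`, `FactorsThroughChains`, `ChainBlindness`, `ChainStructure`, `OccupancyFloorOf`,
  `QuadraticRung`, `Stratification` (+ `stratification_holds : Stratification := Iff.rfl`).
-/

namespace Summit.PneNP.PneNP.Cruxes.SliceTarget.Ideator3

open Finset Filter Literature.Computability.Complexity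
open scoped Classical

noncomputable section

/-- Edge vectors of `K_n`. -/
abbrev EV (n : ℕ) : Type := ((⊤ : SimpleGraph (Fin n)).edgeSet) → Bool

/-- The critical edge count `m_k(n) = ⌊C(n,2)·n^{-2/(k-1)}⌋₊` (verbatim from the route file). -/
def mCrit (n k : ℕ) : ℕ := ⌊((n.choose 2 : ℕ) : ℝ) * (n : ℝ) ^ (-(2 : ℝ) / ((k : ℝ) - 1))⌋₊

/-- The route's central window `|j - m_k(n)| ≤ m_k(n)^{3/4}`. -/
def IsCentral (n k j : ℕ) : Prop := |(j : ℝ) - (mCrit n k : ℝ)| ≤ (mCrit n k : ℝ) ^ ((3 : ℝ) / 4)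

/-- `#slice_j`. -/
def sliceCard (n j : ℕ) : ℕ := #(univ.filter fun x : EV n => edgeCount x = j)

/-- Number of points of slice `j` where `g` disagrees with `f`. -/
def sliceErr (n j : ℕ) (g f : EV n → Bool) : ℕ :=
  #(univ.filter fun x : EV n => edgeCount x = j ∧ g x ≠ f x)

/-! ## Card 1 — critical mod-`q` coincidence -/

/-- The indicator `[q ∤ ω_k(x)]`; for prime `q` this is the `𝔽_q`-polynomial `ω_k(x)^{q-1}`,
`ω_k = Σ_A Π_{e ⊂ A} x_e`, of degree `(q-1)·C(k,2)`. -/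
def modqFn (n k q : ℕ) (x : EV n) : Bool := decide (¬ q ∣ cliqueCount n k x)

/-- The Poisson tail on slice `j`: `#{x : |x| = j, ω_k(x) ≥ q}`. -/
def tailCard (n k q j : ℕ) : ℕ := #(univ.filter fun x : EV n => edgeCount x = j ∧ q ≤ cliqueCount n k x)

/-- Pointwise coincidence off the tail: if `ω_k(x) < q` then `CLIQUE_k(x) = [q ∤ ω_k(x)]`. -/
theorem cliqueFn_eq_modqFn_of_lt {n k q : ℕ} (x : EV n) (h : cliqueCount n k x < q) :
    cliqueFn n k x = modqFn n k q x := by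
  unfold modqFn
  by_cases h0 : cliqueCount n k x = 0
  · rw [(cliqueCount_eq_zero_iff x).1 h0]
    simp [h0]
  · have htrue : cliqueFn n k x = true := by
      cases hc : cliqueFn n k x
      · exact absurd ((cliqueCount_eq_zero_iff x).2 hc) h0
      · rfl
    rw [htrue]
    symm
    rw [decide_eq_true_eq]
    intro hdvd
    exact h0 (Nat.eq_zero_of_dvd_of_lt hdvd h)

/-- Error transfer: on every slice, disagreement with `[q ∤ ω_k]` exceeds disagreement with
`CLIQUE_k` by at most the tail count. -/
theorem sliceErr_modq_le (n k q j : ℕ) (g : EV n → Bool) :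
    sliceErr n j g (modqFn n k q) ≤ sliceErr n j g (cliqueFn n k) + tailCard n k q j := by
  unfold sliceErr tailCard
  calc #(univ.filter fun x : EV n => edgeCount x = j ∧ g x ≠ modqFn n k q x)
      ≤ #((univ.filter fun x : EV n => edgeCount x = j ∧ g x ≠ cliqueFn n k x) ∪
          (univ.filter fun x : EV n => edgeCount x = j ∧ q ≤ cliqueCount n k x)) := by
        apply card_le_card
        intro x hx
        simp only [mem_filter, mem_univ, true_and, mem_union] at hx ⊢
        by_cases hq : cliqueCount n k x < q
        · left
          refine ⟨hx.1, ?_⟩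
          rw [cliqueFn_eq_modqFn_of_lt x hq]
          exact hx.2
        · right
          exact ⟨hx.1, not_lt.1 hq⟩
    _ ≤ _ := card_union_le _ _

/-- **CoincidenceTail** (first-moment Poisson tail on central slices; provable now, M-sized):
for `k ≥ 3`, `q ≥ 1`, `ε > 0`, eventually in `n`, on every central slice
`#{x : |x| = j, ω_k(x) ≥ q} ≤ ((1/k!)^q / q! + ε) · #slice_j`
(by `Pr[ω ≥ q] ≤ E[C(ω,q)]` and the `q`-th factorial moment of `ω_k` on the slice `→ (1/k!)^q`,
strict balance of `K_k` disposing of overlapping `q`-tuples). -/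
def CoincidenceTail : Prop :=
  ∀ k q : ℕ, 3 ≤ k → 1 ≤ q → ∀ ε : ℝ, 0 < ε → ∀ᶠ n : ℕ in atTop, ∀ j : ℕ, IsCentral n k j →
    (tailCard n k q j : ℝ) ≤
      (((Nat.factorial k : ℝ)⁻¹) ^ q / (Nat.factorial q : ℝ) + ε) * (sliceCard n j : ℝ)

/-- **ModqSliceHard q** — the transferred form `C⁺` of card 1: average-case hardness, on the
central slices, of the explicit indicator `[q ∤ ω_k]`, with the error parameter floored above
twice the Poisson tail (so that the transfer to `SliceTarget` has room). -/
def ModqSliceHard (q : ℕ) : Prop :=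
  ∀ c : ℕ, ∃ k : ℕ, 3 ≤ k ∧ ∃ δ : ℝ,
    2 * (((Nat.factorial k : ℝ)⁻¹) ^ q / (Nat.factorial q : ℝ)) < δ ∧
    ∀ᶠ n : ℕ in atTop, ∀ j : ℕ, IsCentral n k j →
      ∀ C : Circuit ((⊤ : SimpleGraph (Fin n)).edgeSet), C.IsOver monotoneBasis →
        (sliceErr n j C.eval (modqFn n k q) : ℝ) ≤ δ * (sliceCard n j : ℝ) → n ^ c < C.size

/-- **TransferModq** (logic + `sliceErr_modq_le` + `CoincidenceTail`; provable now, S/M):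
for every `q ≥ 1`, `ModqSliceHard q` implies the crux (take `δ_X := δ - 2·tail`, `ε := tail/2`). -/
def TransferModq : Prop :=
  ∀ q : ℕ, 1 ≤ q → CoincidenceTail → ModqSliceHard q →
    Summit.PneNP.PneNP.Theses.OneSlice.SliceTarget

/-- The converse direction (same proof with the roles swapped): the crux with its `δ` floored above
twice the tail implies `ModqSliceHard q`; recorded to make the EQUIVALENCE claim of the card precise. -/
def SliceTargetFloored (q : ℕ) : Prop :=
  ∀ c : ℕ, ∃ k : ℕ, 3 ≤ k ∧ ∃ δ : ℝ,
    2 * (((Nat.factorial k : ℝ)⁻¹) ^ q / (Nat.factorial q : ℝ)) < δ ∧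
    ∀ᶠ n : ℕ in atTop, ∀ j : ℕ, IsCentral n k j →
      ∀ C : Circuit ((⊤ : SimpleGraph (Fin n)).edgeSet), C.IsOver monotoneBasis →
        (sliceErr n j C.eval (cliqueFn n k) : ℝ) ≤ δ * (sliceCard n j : ℝ) → n ^ c < C.size

def TransferModqConverse : Prop :=
  ∀ q : ℕ, 1 ≤ q → CoincidenceTail → SliceTargetFloored q → ModqSliceHard q

/-! ## Card 2 — the sub-quadratic window: reading floor, occupancy blindness, `(1+ε₀)N`, `c = 2` -/

/-- Semantic dependence of a Boolean function on the edge slot `e`. -/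
def DependsOn {n : ℕ} (g : EV n → Bool) (e : (⊤ : SimpleGraph (Fin n)).edgeSet) : Prop :=
  ∃ x : EV n, g (Function.update x e true) ≠ g (Function.update x e false)

/-- **ReadingLemma** (locality floor; provable now, M): a function ignoring a `u`-fraction of the
slots misses the cliques through them; contrapositively, `δ`-accuracy on a central slice with
`δ ≤ δ₀(k)` forces dependence on all but `K_k·δ·C(n,2)` slots. -/
def ReadingLemma : Prop :=
  ∀ k : ℕ, 3 ≤ k → ∃ K δ₀ : ℝ, 0 < K ∧ 0 < δ₀ ∧ ∀ δ : ℝ, 0 < δ → δ ≤ δ₀ →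
    ∀ᶠ n : ℕ in atTop, ∀ j : ℕ, IsCentral n k j → ∀ g : EV n → Bool,
      (sliceErr n j g (cliqueFn n k) : ℝ) ≤ δ * (sliceCard n j : ℝ) →
        (1 - K * δ) * ((n.choose 2 : ℕ) : ℝ) ≤ (#(univ.filter fun e => DependsOn g e) : ℝ)

/-- Fan-in-2 DAG connectivity: a circuit depends on at most `size + 1` slots
(provable now from the `Circuit` API, S/M). -/
def SizeGeReads : Prop :=
  ∀ n : ℕ, ∀ C : Circuit ((⊤ : SimpleGraph (Fin n)).edgeSet), C.IsOver monotoneBasis →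
    #(univ.filter fun e => DependsOn C.eval e) ≤ C.size + 1

/-- `X` at a single exponent `c` (the crux is `∀ c, SliceTargetAt c`, see `Stratification`). -/
def SliceTargetAt (c : ℕ) : Prop :=
  ∃ k : ℕ, 3 ≤ k ∧ ∃ δ : ℝ, 0 < δ ∧ ∀ᶠ n : ℕ in atTop, ∀ j : ℕ, IsCentral n k j →
    ∀ C : Circuit ((⊤ : SimpleGraph (Fin n)).edgeSet), C.IsOver monotoneBasis →
      (sliceErr n j C.eval (cliqueFn n k) : ℝ) ≤ δ * (sliceCard n j : ℝ) → n ^ c < C.size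

/-- The stratification of the crux by exponent (definitional unfolding of the route decl). -/
def Stratification : Prop :=
  (∀ c : ℕ, SliceTargetAt c) ↔ Summit.PneNP.PneNP.Theses.OneSlice.SliceTarget

/-- The stratification IS definitional: the crux is literally `∀ c, SliceTargetAt c`. -/
theorem stratification_holds : Stratification := Iff.rfl

/-- The free range: `c ≤ 1` follows from `ReadingLemma` + `SizeGeReads` (size ≥ (1-Kδ)C(n,2) - 1 > n). -/
def FreeRange : Prop := ReadingLemma → SizeGeReads → SliceTargetAt 0 ∧ SliceTargetAt 1

/-- `g` factors through the OCCUPANCY BITS `[x ∩ S_i ≠ ∅]` of slot-groups `S_i` together with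
the full restriction of `x` to an exceptional slot set `E₀`. -/
def FactorsThroughOccupancy {n t : ℕ} (S : Fin t → Finset ((⊤ : SimpleGraph (Fin n)).edgeSet))
    (E₀ : Finset ((⊤ : SimpleGraph (Fin n)).edgeSet)) (g : EV n → Bool) : Prop :=
  ∃ F : (Fin t → Bool) → (((⊤ : SimpleGraph (Fin n)).edgeSet) → Bool) → Bool,
    ∀ x : EV n, g x = F (fun i => decide (∃ e ∈ S i, x e = true)) (fun e => decide (e ∈ E₀) && x e)

/-- **OccupancyBlindness** (the new first lemma of card 2; provable now, M/L): on a central slice,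
a function of the occupancy bits of pairwise disjoint groups of size ≥ 2 covering all slots
outside an exceptional set of ≤ θ·C(n,2) slots errs on ≥ η(k,θ)·#slice_j, for θ ≤ θ₀(k):
given the per-group counts, positions inside groups are independent uniform, and the clique
event keeps conditional probability in `[2^{-C(k,2)}, 1/2]` on a set of profiles of measure ≳ 1/k!. -/
def OccupancyBlindness : Prop :=
  ∀ k : ℕ, 3 ≤ k → ∃ θ₀ : ℝ, 0 < θ₀ ∧ ∀ θ : ℝ, 0 ≤ θ → θ ≤ θ₀ → ∃ η : ℝ, 0 < η ∧
    ∀ᶠ n : ℕ in atTop, ∀ j : ℕ, IsCentral n k j →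
      ∀ (t : ℕ) (S : Fin t → Finset ((⊤ : SimpleGraph (Fin n)).edgeSet))
        (E₀ : Finset ((⊤ : SimpleGraph (Fin n)).edgeSet)),
        (∀ i, 2 ≤ #(S i)) → (∀ i i', i ≠ i' → Disjoint (S i) (S i')) →
        (∀ e, e ∉ E₀ → ∃ i, e ∈ S i) → (#E₀ : ℝ) ≤ θ * ((n.choose 2 : ℕ) : ℝ) →
        ∀ g : EV n → Bool, FactorsThroughOccupancy S E₀ g →
          η * (sliceCard n j : ℝ) ≤ (sliceErr n j g (cliqueFn n k) : ℝ)

/-- **OccupancyFloor** (the line's main provable target, L): there is `ε₀(k) > 0` such that every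
`δ`-accurate (`δ ≤ δ₀(k)`) monotone fan-in-2 circuit on a central slice has more than
`(1+ε₀)·C(n,2)` gates.  Structure: wire counting makes a `(1+ε)N`-gate circuit a union of
`O(εN)` input-fed CHAINS (monotone decision lists); on the sparse slice an `∧`-rung masks
everything below it with probability `1-p`, so all but `O((ε+δ)N)` slots sit in top `∨`-segments,
i.e. the circuit factors through occupancies up to an exceptional set — then `OccupancyBlindness`. -/
def OccupancyFloor : Prop :=
  ∀ k : ℕ, 3 ≤ k → ∃ ε₀ δ₀ : ℝ, 0 < ε₀ ∧ 0 < δ₀ ∧ ∀ δ : ℝ, 0 < δ → δ ≤ δ₀ →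
    ∀ᶠ n : ℕ in atTop, ∀ j : ℕ, IsCentral n k j →
      ∀ C : Circuit ((⊤ : SimpleGraph (Fin n)).edgeSet), C.IsOver monotoneBasis →
        (sliceErr n j C.eval (cliqueFn n k) : ℝ) ≤ δ * (sliceCard n j : ℝ) →
          (1 + ε₀) * ((n.choose 2 : ℕ) : ℝ) < (C.size : ℝ)

/-- A monotone read-once DECISION LIST ("chain"): rungs `(slot, isOr)` listed top-down, applied to a
bottom value `b`; `(e, true)` is the rung `x_e ∨ ·`, `(e, false)` the rung `x_e ∧ ·`.  A maximal run of
input-fed fan-in-2 gates `u_i = x_{e_i} ∘_i u_{i-1}` in a circuit computes exactly this. -/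
def chainEval {n : ℕ} : List (((⊤ : SimpleGraph (Fin n)).edgeSet) × Bool) → Bool → EV n → Bool
  | [], b, _ => b
  | (e, true) :: rs, b, x => x e || chainEval rs b x
  | (e, false) :: rs, b, x => x e && chainEval rs b x

/-- `g` factors EXACTLY through a triangular system of chains: chain `i` is evaluated with a bottom
value selected by `B i` from the outputs of the chains `< i` and the raw values on `E₀`, and `g` is
a function of all chain outputs and the raw values on `E₀`. (Occupancy groups are the special case
of pure-`∨` chains with bottom `false`.) -/
def FactorsThroughChains {n t : ℕ} (ℓ : Fin t → List (((⊤ : SimpleGraph (Fin n)).edgeSet) × Bool))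
    (E₀ : Finset ((⊤ : SimpleGraph (Fin n)).edgeSet)) (g : EV n → Bool) : Prop :=
  ∃ (B : Fin t → (Fin t → Bool) → ((((⊤ : SimpleGraph (Fin n)).edgeSet)) → Bool) → Bool)
    (F : (Fin t → Bool) → ((((⊤ : SimpleGraph (Fin n)).edgeSet)) → Bool) → Bool),
    (∀ i (D D' : Fin t → Bool) (y : _ → Bool), (∀ i', i' < i → D i' = D' i') → B i D y = B i D' y) ∧
    ∀ x : EV n, ∃ D : Fin t → Bool,
      (∀ i, D i = chainEval (ℓ i) (B i D (fun e => decide (e ∈ E₀) && x e)) x) ∧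
      g x = F D (fun e => decide (e ∈ E₀) && x e)

/-- **ChainBlindness** (generalises `OccupancyBlindness`; provable now, L): if `g` factors through
chains of length ≥ 2 over pairwise disjoint private slot sets covering everything outside a raw set
`E₀` of ≤ θ·C(n,2) slots (θ ≤ θ₀ < 1), then `g` errs on ≥ η(k,θ)·#slice_j of every central slice:
`2·err ≥ P[CLIQUE(x) ≠ CLIQUE(x'')]` for `x''` resampled given the revealed data, and a chain reveals
(typically) at most its top rung raw, so a uniformly placed clique keeps a hidden slot. -/
def ChainBlindness : Prop :=
  ∀ k : ℕ, 3 ≤ k → ∀ θ : ℝ, 0 ≤ θ → θ < 1 → ∃ η : ℝ, 0 < η ∧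
    ∀ᶠ n : ℕ in atTop, ∀ j : ℕ, IsCentral n k j →
      ∀ (t : ℕ) (ℓ : Fin t → List (((⊤ : SimpleGraph (Fin n)).edgeSet) × Bool))
        (E₀ : Finset ((⊤ : SimpleGraph (Fin n)).edgeSet)),
        (∀ i, 2 ≤ (ℓ i).length) → (∀ i, ((ℓ i).map Prod.fst).Nodup) →
        (∀ i i', i ≠ i' → Disjoint ((ℓ i).map Prod.fst).toFinset ((ℓ i').map Prod.fst).toFinset) →
        (∀ i, Disjoint ((ℓ i).map Prod.fst).toFinset E₀) →
        (∀ e, e ∉ E₀ → ∃ i, e ∈ (ℓ i).map Prod.fst) → (#E₀ : ℝ) ≤ θ * ((n.choose 2 : ℕ) : ℝ) →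
        ∀ g : EV n → Bool, FactorsThroughChains ℓ E₀ g →
          η * (sliceCard n j : ℝ) ≤ (sliceErr n j g (cliqueFn n k) : ℝ)

/-- **ChainStructure** (pure wire-counting, no probability; provable now from the `Circuit` API, M/L):
a monotone fan-in-2 circuit with at most `(1+ε)·C(n,2)` gates factors exactly through chains of
length ≥ 2 over private slots, with a raw set of size `O(ε·C(n,2) + #(slots it does not depend on) + 1)`
(raw = multiply-read slots and tops of singleton chains). -/
def ChainStructure : Prop :=
  ∃ c₀ : ℝ, 0 < c₀ ∧ ∀ (n : ℕ) (ε : ℝ), 0 ≤ ε →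
    ∀ C : Circuit ((⊤ : SimpleGraph (Fin n)).edgeSet), C.IsOver monotoneBasis →
      (C.size : ℝ) ≤ (1 + ε) * ((n.choose 2 : ℕ) : ℝ) →
      ∃ (t : ℕ) (ℓ : Fin t → List (((⊤ : SimpleGraph (Fin n)).edgeSet) × Bool))
        (E₀ : Finset ((⊤ : SimpleGraph (Fin n)).edgeSet)),
        (∀ i, 2 ≤ (ℓ i).length) ∧ (∀ i, ((ℓ i).map Prod.fst).Nodup) ∧
        (∀ i i', i ≠ i' → Disjoint ((ℓ i).map Prod.fst).toFinset ((ℓ i').map Prod.fst).toFinset) ∧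
        (∀ i, Disjoint ((ℓ i).map Prod.fst).toFinset E₀) ∧
        (∀ e, e ∉ E₀ → ∃ i, e ∈ (ℓ i).map Prod.fst) ∧
        (#E₀ : ℝ) ≤ c₀ * (ε * ((n.choose 2 : ℕ) : ℝ) +
          (((n.choose 2 : ℕ) : ℝ) - (#(univ.filter fun e => DependsOn C.eval e) : ℝ)) + 1) ∧
        FactorsThroughChains ℓ E₀ C.eval

/-- The `(1+ε₀)N` theorem as a composition of the three lemmas above. -/
def OccupancyFloorOf : Prop := ReadingLemma → ChainStructure → ChainBlindness → OccupancyFloor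

/-- **QuadraticRung** — `X` at `c = 2`, i.e. more than `n² = 2·C(n,2) + n` gates: the crux-let of
card 2 ("two reads per slot do not suffice"); it sits strictly below the Berkowitz overhead
`O(C(n,2) log² n)`, hence implies NO general-circuit lower bound. -/
def QuadraticRung : Prop := SliceTargetAt 2

end

end Summit.PneNP.PneNP.Cruxes.SliceTarget.Ideator3
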